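import Summits.BirchSwinnertonDyer.BirchSwinnertonDyer.Theorems.PrintX11aUpperNonSurjFiveUnitSector
import HarnessLib

/-!
# Route `PrintX11a`, crux U5 = `Theses.PrintX11a.UpperNonSurjFive` (item stmt-BirchSwinnertonDyer-20614), line of record «gl1cartan5»
# (rev 9): TAMAGAWA DIVISIBILITY at the non-surjective X11a pairs — `p ∣ c_ℓ ⟹ p ∣ L(E,1)/Ω_E` modulo the nine print facts — and
# consequently each NON-UNIT core recovers its rev-8 parent residual ON ITS OWN modulo the eight facts (route-file-free module)

Cell `bsd-print-x11a`, LEAD `cruxlead-stmt-BirchSwinnertonDyer-20614` g4 (`--supports stmt-BirchSwinnertonDyer-20614 --as helper`).  THEOREMS ONLY: no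
definition, no named fact minted, no `sorry`; CONDITIONAL on named published facts displayed as hypotheses; nothing is asserted about any
curve; item 20614 is NOT closed by this file.  Sequel of `Theorems/PrintX11aUpperNonSurjFiveUnitSector.lean` (p671927) and
`Theorems/PrintX11aUpperNonSurjFiveCoreResiduals.lean` (p673333); this module does not import the route file.

THE POINT.  The unit-sector theorem (p671927: at a NON-split `p` with `ord_p (L(E,1)/Ω_E) = 0` the Euler half `MissingUpperBoundAt W p`
holds, modulo eight print-exact facts) has an ARITHMETIC consequence that BSD predicts but that was only a census remark in rev 8/9:

* §1 `GL1Cartan.one_le_padicValRat_LOne_div_of_exists_split` — **Tamagawa divisibility (CONDITIONAL on the nine facts).**  At an X11a pair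
  with `ρ̄_{E,p}` not surjective, `5 ≤ p`, `p` NON-split and SOME split multiplicative prime `ℓ`: `ord_p (L(E,1)/Ω_E) ≥ 1`.  For `ℓ ≠ p`
  (forced: `p` is non-split) the class has no (ram) witness, so `p ∣ v_ℓ(Δ_min) = c_ℓ` and `p ∣ ∏ c` (`X11b.dvd_tamagawaProduct_iff_exists_split`);
  if `L(E,1)/Ω_E` were a `p`-adic unit the unit-sector theorem would give `0 ≤ ord_p #Ш ≤ ord_p #Ш_an`, while
  `#Ш_an = (L/Ω)·#E(ℚ)²/∏ c` (Gross–Zagier–Kolyvagin, analytic rank `0`) with `p ∤ #E(ℚ)` (irreducible `E[p]`) has `ord_p #Ш_an ≤ −1` —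
  contradiction.  So the hard-locus clause of the Tamagawa core R₁′♭ is AUTOMATIC modulo the nine facts
  (`GL1Cartan.hardLocus_of_exists_split_of_nineFacts`).
* §2 each core recovers its rev-8 parent BY ITSELF modulo the eight facts: `GL1Cartan.pTorsionResidual_of_eightFacts_of_core` (R′♭ ⇒ R′) and
  `GL1Cartan.splitMultResidual_of_eightFacts_of_core` (R₁′♭ ⇒ R₁′) — off the hard locus the unit-sector theorem serves the parent directly;
  sharper than `arithResiduals_of_nineFacts_of_coreResiduals` (p673333), which went through U5 and needed both cores at once.

HONEST FRAMING.  §1 is a consequence of the cell's μ-road facts, not a new Euler-system bound; it bounds no `Ш`.  The cores R′♭/R₁′♭ stay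
open (same wall: an exponent-`≥ 1` Euler-system bound at mod-`p` image `N(C_s)`/`5S4`, or Greenberg's analytic `μ = 0` on the hard locus).
The leaf `ClassX11a` is not closed; no statement of the summit is proved; BSD is not proved by any of this.  «beyond-print theorem: NO».

References: [MazurTateTeitelbaum1986] §I.10, §I.14; [Kato2004Asterisque] Thm. 12.4 (p. 221), §17.13 (pp. 279–280); [SteinWuthrich2013] Thm. 6.1
(p. 20); [Mazur1978] Cor. 4.1; [Mazur1977] Ch. III §5 (p. 157); [SilvermanATAEC1994] Cor. IV.9.2 (d) and Table 4.1; [Miller2011LMS] Def. 1.1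
(arXiv:1010.2431 p. 3); [SkinnerUrban2014] Thm. 2 (p. 3) (the (ram) hypothesis, absent on X11a).
-/

-- justified: the file namespace `Summit.BirchSwinnertonDyer.BirchSwinnertonDyer.Theorems.GL1Cartan` repeats the sub-problem segment by the D-0017 layout
set_option linter.dupNamespace false
set_option autoImplicit false

noncomputable section

open scoped Classical NumberField MatrixGroups ModularForm

open CongruenceSubgroup WeierstrassCurve
  Literature.NumberTheory.EllipticCurves
  Literature.NumberTheory.EllipticCurves.ModularForms
  Literature.NumberTheory.EllipticCurves.Rank1Residual
  Literature.NumberTheory.EllipticCurves.Rank1Residual.Typed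
  Literature.NumberTheory.EllipticCurves.SteinWuthrich2013
  Literature.NumberTheory.EllipticCurves.Kato2004
  Literature.NumberTheory.EllipticCurves.Wuthrich2014
  Summit.BirchSwinnertonDyer.Rank1Residual
  Summit.BirchSwinnertonDyer.Rank1Residual.X11b

namespace Summit.BirchSwinnertonDyer.BirchSwinnertonDyer.Theorems.GL1Cartan

/-! ## §1 Tamagawa divisibility at the non-surjective X11a pairs (modulo the nine facts) -/

/-- **Tamagawa divisibility: `p ∣ c_ℓ ⟹ p ∣ L(E,1)/Ω_E` at a non-surjective X11a pair (CONDITIONAL on nine named print facts).**  For minimal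
`E/ℚ` in class X11a with `ρ̄_{E,p}` not surjective, `5 ≤ p`, `p` NON-split multiplicative, and some SPLIT multiplicative prime (necessarily
`ℓ ≠ p`; no (ram) witness ⟹ `p ∣ v_ℓ(Δ_min) = c_ℓ`): the rational `t = L(E,1)/Ω_E` has `ord_p t ≥ 1`.  Otherwise `ord_p t = 0` (it is `≥ 0`
by modularity + Mazur), the unit-sector theorem `ClassX11a.missingUpperBoundAt_of_not_surj_of_nonsplit_of_unitValue_contra` (eight facts) gives
`0 ≤ ord_p #Ш ≤ ord_p #Ш_an`, and `#Ш_an = t·#E(ℚ)²/∏ c` (GZK) with `p ∤ #E(ℚ)`, `p ∣ ∏ c` has `ord_p #Ш_an ≤ −1`.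
[cite: SilvermanATAEC1994, Cor. IV.9.2 (d) and Table 4.1] [cite: Mazur1977, Ch. III §5 (p. 157)] [cite: Kato2004Asterisque, §17.13 (pp. 279–280)]
[cite: Miller2011LMS, Def. 1.1 (arXiv:1010.2431 p. 3)] -/
theorem one_le_padicValRat_LOne_div_of_exists_split
    (hJs : thm61_splitMultiplicative) (hJn : thm61_nonsplitMultiplicative)
    (h12 : Kato2004.thm12_4) (hnf : exists_isNewformOf)
    (hns' : Kato2004.exists_multDivisibilityInputs_nonsplit_contra)
    (hsp' : Kato2004.exists_multDivisibilityInputs_split_contra)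
    (hfine' : Kato2004.exists_multDivisibilityInputs_fine_contra) (hMz : mazur_not_dvd_maninConstant_of_odd)
    (hGZK : rank_eq_analyticRank_of_analyticRank_le_one)
    {W : WeierstrassCurve ℚ} [W.IsElliptic] [W.IsGloballyMinimal] {p : ℕ} [Fact p.Prime]
    (hX : ClassX11a W p) (hns : ¬ Surj W p) (hp5 : 5 ≤ p) (hnsp : ¬ W.HasSplitMultiplicativeReductionAtPrime p)
    (hsm : ∃ (ℓ : ℕ) (_ : Fact ℓ.Prime), W.HasSplitMultiplicativeReductionAtPrime ℓ)
    {t : ℚ} (ht : W.entireLFunction 1 / (W.realPeriodRat : ℂ) = (t : ℂ)) : 1 ≤ padicValRat p t := by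
  have hp : p.Prime := Fact.out
  obtain ⟨t', ht', ht0', hv0⟩ := hX.exists_LOne_div_realPeriod_eq_of_mazur hnf hMz hp5
  have htt : t = t' := by exact_mod_cast ht.symm.trans ht'
  subst htt
  by_contra hlt
  have hunit : padicValRat p t = 0 := by
    push Not at hlt
    omega
  -- the unit-sector theorem: `0 ≤ ord_p #Ш ≤ ord_p #Ш_an`
  obtain ⟨q, hq, hle⟩ := hX.missingUpperBoundAt_of_not_surj_of_nonsplit_of_unitValue_contra hJs hJn h12 hnf hns' hsp'
    hfine' hMz W p hns hnsp ht hunit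
  -- `#Ш_an = t · #E(ℚ)² / ∏ c`
  have hL1 : W.entireLFunction 1 ≠ 0 := by
    intro h0
    apply ht0'
    have h : ((t : ℚ) : ℂ) = 0 := by rw [← ht, h0, zero_div]
    exact_mod_cast h
  obtain ⟨-, hE, -, hsha⟩ := shaAn_eq_of_L_one_div_eq hGZK W hL1 ht
  haveI := hE
  have hqq : q = t * (Nat.card W.toAffine.Point : ℚ) ^ 2 / (W.tamagawaProduct : ℚ) := by
    exact_mod_cast hq.symm.trans hsha
  subst hqq
  -- `p ∤ #E(ℚ)` (irreducible `E[p]`), `p ∣ ∏ c` (a split multiplicative `ℓ ≠ p` with `p ∣ v_ℓ(Δ_min)`: no (ram) witness on X11a)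
  have hcardE : ¬ p ∣ Nat.card W.toAffine.Point := fun hdvd =>
    not_exists_addOrderOf_eq_of_hasIrreducibleModPGaloisRep W hX.irr
      (exists_prime_addOrderOf_dvd_card' (G := W.toAffine.Point) p hdvd)
  obtain ⟨ℓ, hℓ, hsplit⟩ := hsm
  have hℓp : ℓ ≠ p := by
    rintro rfl
    exact hnsp hsplit
  have hdvdΔ : p ∣ padicValInt ℓ W.minimalDiscriminantInt := by
    by_contra hnd
    exact hX.not_ram ⟨ℓ, hℓ, hℓp, hsplit.hasMultiplicativeReductionAtPrime, hnd⟩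
  have htam : p ∣ W.tamagawaProduct :=
    (X11b.dvd_tamagawaProduct_iff_exists_split W hp hp5).mpr ⟨ℓ, hℓ, hsplit, hdvdΔ⟩
  have hcard0 : (Nat.card W.toAffine.Point : ℚ) ≠ 0 := by
    exact_mod_cast (Nat.card_pos (α := W.toAffine.Point)).ne'
  have htampos : 0 < W.tamagawaProduct := W.tamagawaProduct_pos_holds
  have htam0 : (W.tamagawaProduct : ℚ) ≠ 0 := by exact_mod_cast htampos.ne'
  have hcardv : padicValRat p (Nat.card W.toAffine.Point : ℚ) = 0 := by
    rw [padicValRat.of_nat, padicValNat.eq_zero_of_not_dvd hcardE, Nat.cast_zero]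
  have htamv : (1 : ℤ) ≤ padicValRat p (W.tamagawaProduct : ℚ) := by
    rw [padicValRat.of_nat]
    exact_mod_cast one_le_padicValNat_of_dvd htampos.ne' htam
  have hvq : padicValRat p (t * (Nat.card W.toAffine.Point : ℚ) ^ 2 / (W.tamagawaProduct : ℚ)) =
      padicValRat p t + 2 * padicValRat p (Nat.card W.toAffine.Point : ℚ) - padicValRat p (W.tamagawaProduct : ℚ) := by
    rw [padicValRat.div (mul_ne_zero ht0' (pow_ne_zero 2 hcard0)) htam0,
      padicValRat.mul ht0' (pow_ne_zero 2 hcard0), padicValRat.pow]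
    push_cast
    ring
  have h0 : (0 : ℤ) ≤ (padicValNat p W.shaOrder : ℤ) := by exact_mod_cast Nat.zero_le _
  rw [hvq, hunit, hcardv] at hle
  linarith

/-- **The hard-locus clause of the Tamagawa core is automatic (CONDITIONAL on the nine facts).**  At an X11a pair with `ρ̄_{E,p}` not surjective,
`5 ≤ p` and some split multiplicative prime, the pair lies on the μ-road's hard locus «`p` split multiplicative, or `L(E,1)/Ω_E` of non-zero
`p`-adic valuation» (the verbatim antecedent of the rung `Theorems.X11aNonSurjMuAnHardFive`): if `p` is non-split, §1 gives `ord_p (L(E,1)/Ω_E) ≥ 1`.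
So rev 9's R₁′♭ and rev 8's R₁′ quantify over the SAME pairs modulo the nine facts. [cite: SilvermanATAEC1994, Cor. IV.9.2 (d)]
[cite: Kato2004Asterisque, §17.13 (pp. 279–280)] -/
theorem hardLocus_of_exists_split_of_nineFacts
    (hJs : thm61_splitMultiplicative) (hJn : thm61_nonsplitMultiplicative)
    (h12 : Kato2004.thm12_4) (hnf : exists_isNewformOf)
    (hns' : Kato2004.exists_multDivisibilityInputs_nonsplit_contra)
    (hsp' : Kato2004.exists_multDivisibilityInputs_split_contra)
    (hfine' : Kato2004.exists_multDivisibilityInputs_fine_contra) (hMz : mazur_not_dvd_maninConstant_of_odd)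
    (hGZK : rank_eq_analyticRank_of_analyticRank_le_one)
    {W : WeierstrassCurve ℚ} [W.IsElliptic] [W.IsGloballyMinimal] {p : ℕ} [Fact p.Prime]
    (hX : ClassX11a W p) (hns : ¬ Surj W p) (hp5 : 5 ≤ p)
    (hsm : ∃ (ℓ : ℕ) (_ : Fact ℓ.Prime), W.HasSplitMultiplicativeReductionAtPrime ℓ) :
    W.HasSplitMultiplicativeReductionAtPrime p ∨
      ∀ t : ℚ, W.entireLFunction 1 / (W.realPeriodRat : ℂ) = (t : ℂ) → padicValRat p t ≠ 0 := by
  by_cases hsp : W.HasSplitMultiplicativeReductionAtPrime p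
  · exact Or.inl hsp
  · refine Or.inr fun t ht h0 => ?_
    have h1 := one_le_padicValRat_LOne_div_of_exists_split hJs hJn h12 hnf hns' hsp' hfine' hMz hGZK hX hns hp5 hsp hsm ht
    rw [h0] at h1
    exact absurd h1 (by norm_num)

/-! ## §2 Each non-unit core recovers its rev-8 parent on its own (modulo the eight facts) -/

/-- **R′♭ ⇒ R′ modulo the eight facts.**  The rev-8 exponent residual («no split multiplicative prime, `Ш(E)[p] ≠ 0` ⇒ `MissingUpperBoundAt`»)
follows from its non-unit core: at a pair with `ord_p (L(E,1)/Ω_E) = 0` (`p` is non-split since no prime is split multiplicative) the unit-sector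
theorem serves the conclusion directly; elsewhere the core applies. [cite: MazurTateTeitelbaum1986, §I.10 and §I.14] [cite: Kato2004Asterisque, §17.13 (pp. 279–280)] -/
theorem pTorsionResidual_of_eightFacts_of_core
    (hJs : thm61_splitMultiplicative) (hJn : thm61_nonsplitMultiplicative)
    (h12 : Kato2004.thm12_4) (hnf : exists_isNewformOf)
    (hns' : Kato2004.exists_multDivisibilityInputs_nonsplit_contra)
    (hsp' : Kato2004.exists_multDivisibilityInputs_split_contra)
    (hfine' : Kato2004.exists_multDivisibilityInputs_fine_contra) (hMz : mazur_not_dvd_maninConstant_of_odd)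
    (hC' : ∀ (W : WeierstrassCurve ℚ) [W.IsElliptic] [W.IsGloballyMinimal] (p : ℕ) [Fact p.Prime],
      ClassX11a W p → ¬ Surj W p → 5 ≤ p → (∀ (ℓ : ℕ) [Fact ℓ.Prime], ¬ W.HasSplitMultiplicativeReductionAtPrime ℓ) →
      (∃ x : W.sha, (p : ℤ) • x = 0 ∧ x ≠ 0) →
      (∀ t : ℚ, W.entireLFunction 1 / (W.realPeriodRat : ℂ) = (t : ℂ) → padicValRat p t ≠ 0) →
      MissingUpperBoundAt W p) :
    ∀ (W : WeierstrassCurve ℚ) [W.IsElliptic] [W.IsGloballyMinimal] (p : ℕ) [Fact p.Prime],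
      ClassX11a W p → ¬ Surj W p → 5 ≤ p → (∀ (ℓ : ℕ) [Fact ℓ.Prime], ¬ W.HasSplitMultiplicativeReductionAtPrime ℓ) →
      (∃ x : W.sha, (p : ℤ) • x = 0 ∧ x ≠ 0) → MissingUpperBoundAt W p := by
  intro W _ _ p _ hX hns hp5 hnsm hSha
  by_cases hval : ∀ t : ℚ, W.entireLFunction 1 / (W.realPeriodRat : ℂ) = (t : ℂ) → padicValRat p t ≠ 0
  · exact hC' W p hX hns hp5 hnsm hSha hval
  · push Not at hval
    obtain ⟨t, ht, hunit⟩ := hval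
    exact hX.missingUpperBoundAt_of_not_surj_of_nonsplit_of_unitValue_contra hJs hJn h12 hnf hns' hsp' hfine' hMz W p hns
      (hnsm p) ht hunit

/-- **R₁′♭ ⇒ R₁′ modulo the eight facts.**  The rev-8 Tamagawa residual («some split multiplicative prime ⇒ `MissingUpperBoundAt`») follows from
its hard-locus core: off the hard locus (`p` non-split and `ord_p (L(E,1)/Ω_E) = 0`) the unit-sector theorem serves the conclusion directly (by
§1 that locus is even empty modulo the nine facts); on it the core applies. [cite: MazurTateTeitelbaum1986, §I.10 and §I.14]
[cite: Kato2004Asterisque, §17.13 (pp. 279–280)] -/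
theorem splitMultResidual_of_eightFacts_of_core
    (hJs : thm61_splitMultiplicative) (hJn : thm61_nonsplitMultiplicative)
    (h12 : Kato2004.thm12_4) (hnf : exists_isNewformOf)
    (hns' : Kato2004.exists_multDivisibilityInputs_nonsplit_contra)
    (hsp' : Kato2004.exists_multDivisibilityInputs_split_contra)
    (hfine' : Kato2004.exists_multDivisibilityInputs_fine_contra) (hMz : mazur_not_dvd_maninConstant_of_odd)
    (hC₁' : ∀ (W : WeierstrassCurve ℚ) [W.IsElliptic] [W.IsGloballyMinimal] (p : ℕ) [Fact p.Prime],
      ClassX11a W p → ¬ Surj W p → 5 ≤ p →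
      (∃ (ℓ : ℕ) (_ : Fact ℓ.Prime), W.HasSplitMultiplicativeReductionAtPrime ℓ) →
      (W.HasSplitMultiplicativeReductionAtPrime p ∨
        ∀ t : ℚ, W.entireLFunction 1 / (W.realPeriodRat : ℂ) = (t : ℂ) → padicValRat p t ≠ 0) →
      MissingUpperBoundAt W p) :
    ∀ (W : WeierstrassCurve ℚ) [W.IsElliptic] [W.IsGloballyMinimal] (p : ℕ) [Fact p.Prime],
      ClassX11a W p → ¬ Surj W p → 5 ≤ p →
      (∃ (ℓ : ℕ) (_ : Fact ℓ.Prime), W.HasSplitMultiplicativeReductionAtPrime ℓ) → MissingUpperBoundAt W p := by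
  intro W _ _ p _ hX hns hp5 hsm
  by_cases hhard : W.HasSplitMultiplicativeReductionAtPrime p ∨
      ∀ t : ℚ, W.entireLFunction 1 / (W.realPeriodRat : ℂ) = (t : ℂ) → padicValRat p t ≠ 0
  · exact hC₁' W p hX hns hp5 hsm hhard
  · simp only [not_or, not_forall, not_not] at hhard
    obtain ⟨hnsp, t, ht, hunit⟩ := hhard
    exact hX.missingUpperBoundAt_of_not_surj_of_nonsplit_of_unitValue_contra hJs hJn h12 hnf hns' hsp' hfine' hMz W p hns
      hnsp ht hunit

end Summit.BirchSwinnertonDyer.BirchSwinnertonDyer.Theorems.GL1Cartan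

end
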